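import Summits.HodgeConjecture.HodgeConjecture.Theorems.F0P2oStubDictTorusChar            -- ★ K2 (F0P2-p02 (g5) p826011): `coe_localDet_localPiEquiv_theta`, `exists_quotConj_eq_of_nonsplit` (local Hilbert 90)
import Literature.NumberTheory.GelbartRogawski1991.ThetaDichotomyVocabulary                -- ★ typ-T7a p826013: `IsThetaCenterChar`
import Literature.NumberTheory.Automorphic.Liu2021.Def411WeilCarriersTripleSeparation        -- ★ `localCharOfCenter_theta_eq` (the centre inclusion at `v` does not see the line)
import HarnessLib

/-!
# Crux `H413`, programme P2 — GLUE-I: the `U(1)`-character `ψθ` of the theta datum does NOT depend on the line `ε`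

Cell hodgecm-mathlib (D-0151), FLOOR 0, crux H413 = stmt-HodgeConjecture-24833; helper of the U′-N pay-down line `Cruxes/H413/Lines/F0_P2GR91NJacquet.lean`
(K1 sub-line `…/F0_P2GR91NJacquetK1.lean`) and of typ-T7b's local-D7α Lines draft `F0/P2/Lines-draft/T7b_LocalThetaDichotomy.lean` (v1.5), whose
registered-shape stub GLUE-I `StubThetaCenterCharIndep` (:273–280; owner F0P2-p02) this file closes BY NAME (`stubThetaCenterCharIndep_holds`, body VERBATIM).

THE MATHEMATICS.  ★ `IsThetaCenterChar L μ χf ε v ψθ` [GelbartRogawski1991 §5.1 (5.1.1) p. 465: GR's `χ_v(γ_v¹)⁻¹`] reads an element `u` of the local unitary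
group `U((ε))(L⁺_v)` of the LINE `⟨ε⟩` only through `det u ∈ E¹_v` and through the centre character `χ_{f,v}(u)` (★ `localCharOfCenter`, i.e. `χ_f` at the
finite-adèlic point «`det u` at the places over `v`, `1` elsewhere»).  Every `u` is a norm-one scalar `θ_ε(z) = (z)` (★ `LemD1OfPlace.theta_surjective`), with
`det θ_ε(z) = z` (★ `coe_localDet_localPiEquiv_theta`) and `χ_{f,v}(θ_ε z) = χ_{f,v}(θ_{ε′} z)` (★ `localCharOfCenter_theta_eq`) — so the defining identity at the line
`ε` IS the defining identity at the line `ε′` (§1, EVERY finite `v`, split or not).  At a NON-SPLIT `v` more is true (§2): `ψθ` is DETERMINED by `(μ, χ_f)` — on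
quotients `x/x̄` it is `χ_f(∏_{w∣v} single_w(x_w) / conj) · μ_v(x/x̄)⁻¹` (★ `CheckOfChi.finAdelicCheck_prod_unitsMap_finiteAdeleSingle`), and every norm-one unit
of `L ⊗ L⁺_v` is such a quotient (local Hilbert 90, ★ `exists_quotConj_eq_of_nonsplit`) — so two characters with ★ `IsThetaCenterChar` for the same `(μ, χ_f)` and
any two lines coincide (`isThetaCenterChar_unique`).  §2 is F0P2-p02 (g5)'s GREEN salvage `F0/P2/p02/F0P2oK1aWOfN3.sec1-4.GREEN.F0P2p02g5.lean` §2 verbatim.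
THEOREMS ONLY (no `def`, no named fact, no `sorry`); nothing here is conditional.  HC_CM is proved only modulo the printed citations until rung 0 closes;
nothing here proves a letter.

## References
* [GelbartRogawski1991] S. Gelbart, J. Rogawski, Invent. Math. 105 (1991): §5.1 (5.1.1) p. 465; proof of Prop. 5.2.1 p. 467 L25–27; Remark p. 466.
* [Liu2021] Y. Liu, Camb. J. Math. 9 (2021): Def. 4.1, App. D §D.1 Steps 1–3 (l. 5217–5224).
* [TateThesis1967] J. Tate, in Cassels–Fröhlich (1967): §3.2 Lemma 3.2.1 (local components of an idèle class character).
* [CasselsFrohlichANT1967] Ch. V §2.7 Prop. 5; Ch. VI §1.7 (Hilbert 90).  [Mok2014] Mem. AMS 235: §1 Notation p. 5.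
-/

set_option autoImplicit false
-- the mandated namespace has the single-problem summit's repeated segment (`HodgeConjecture.HodgeConjecture`)
set_option linter.dupNamespace false

noncomputable section

open NumberField IsDedekindDomain MeasureTheory
open scoped Matrix

open Literature.NumberTheory Literature.NumberTheory.Automorphic Literature.NumberTheory.Automorphic.UnitaryGroup
open Literature.NumberTheory.Automorphic.IdeleClassGroup
open Literature.NumberTheory.Automorphic.Liu2021 Literature.NumberTheory.Automorphic.Liu2021.Def411WeilCarriers
open Literature.NumberTheory.GaloisRepresentations
open Literature.NumberTheory.Rogawski1990
open Literature.NumberTheory.GelbartRogawski1991 Literature.NumberTheory.GelbartRogawski1991.UnitaryDualPair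
open Literature.RepresentationTheory.Liu2021

namespace Summit.HodgeConjecture.HodgeConjecture.Cruxes.H413.F0P2oThetaCenterCharIndep

variable (L : Type) [Field L] [NumberField L] [IsCMField L]

/-! ## §0 The rank-2 standing data `(2, 1, imagUnit)` at `v` carrying `θ` (as in ★ K2 `F0P2oStubDictTorusChar` §4 and ★ `F0P2oK1aWOfLetters` §0) -/

/-- `c (imagUnit L) = −imagUnit L`. [cite: Liu2021, App. D §D.1 Step 1] -/
private theorem hcδ' : IsCMField.complexConj L (imagUnit L) = -imagUnit L := complexConj_imagUnit L

/-- `(1 : M₂(L))` is hermitian. [folklore] -/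
private theorem one_map_transpose : ((1 : Matrix (Fin 2) (Fin 2) L).map (IsCMField.complexConj L))ᵀ = 1 := by
  rw [Matrix.map_one (IsCMField.complexConj L) (map_zero _) (map_one _), Matrix.transpose_one]

omit [IsCMField L] in
/-- `det (1 : M₂(L)) ≠ 0`. [folklore] -/
private theorem one_det_ne_zero : (1 : Matrix (Fin 2) (Fin 2) L).det ≠ 0 := by
  rw [Matrix.det_one]; exact one_ne_zero

/-! ## §1 GLUE-I at EVERY finite place: the defining identity of `ψθ` does not see the line -/

set_option synthInstance.maxHeartbeats 400000 in
set_option maxHeartbeats 8000000 in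
/-- **`det θ_ε(z) = det θ_{ε′}(z)` in `E¹_v`** (both are `z`: ★ `coe_localDet_localPiEquiv_theta`), for the norm-one scalars `θ` of the rank-2 standing data at `v`
presented on the two lines `⟨ε⟩`, `⟨ε′⟩`. [cite: Mok2014, §1 Notation p. 5] -/
theorem localDet_theta_eq_localDet_theta (v : HeightOneSpectrum (𝓞 ↥(maximalRealSubfield L))) (ε ε' : (↥(maximalRealSubfield L))ˣ)
    (z : (LemD1OfPlace.standingData L v (IsCMField.complexConj L) 2 (1 : Matrix (Fin 2) (Fin 2) L) (hcδ' L) (imagUnit_ne_zero L)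
      le_rfl (one_map_transpose L) (one_det_ne_zero L)).normOne) :
    localDet (IsCMField.complexConj L) v
        (isUnit_iff_ne_zero.mpr (by rw [Matrix.det_fin_one]; exact JW_apply_ne_zero (↥(maximalRealSubfield L)) L ε))
        (localPiEquiv L (IsCMField.complexConj L) 1 (JW (↥(maximalRealSubfield L)) L ε) v
          (LemD1OfPlace.theta L v (IsCMField.complexConj L) 2 (1 : Matrix (Fin 2) (Fin 2) L) (hcδ' L) (imagUnit_ne_zero L) le_rfl
            (one_map_transpose L) (one_det_ne_zero L) (JW (↥(maximalRealSubfield L)) L ε) z)) =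
      localDet (IsCMField.complexConj L) v
        (isUnit_iff_ne_zero.mpr (by rw [Matrix.det_fin_one]; exact JW_apply_ne_zero (↥(maximalRealSubfield L)) L ε'))
        (localPiEquiv L (IsCMField.complexConj L) 1 (JW (↥(maximalRealSubfield L)) L ε') v
          (LemD1OfPlace.theta L v (IsCMField.complexConj L) 2 (1 : Matrix (Fin 2) (Fin 2) L) (hcδ' L) (imagUnit_ne_zero L) le_rfl
            (one_map_transpose L) (one_det_ne_zero L) (JW (↥(maximalRealSubfield L)) L ε') z)) :=
  Subtype.ext ((F0P2oStubDictTorusChar.coe_localDet_localPiEquiv_theta L v _ z).trans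
    (F0P2oStubDictTorusChar.coe_localDet_localPiEquiv_theta L v _ z).symm)

set_option synthInstance.maxHeartbeats 400000 in
set_option maxHeartbeats 8000000 in
/-- **GLUE-I — `IsThetaCenterChar` DOES NOT DEPEND ON THE LINE (every finite `v`, split or not).**  If `ψθ(det u) = χ_{f,v}(u)·μ_v(det u)⁻¹` on
`U((ε))(L⁺_v)` then the same identity holds on `U((ε′))(L⁺_v)`: write `u′ = θ_{ε′}(z)` (★ `theta_surjective`), so `det u′ = z = det θ_ε(z)`
(`localDet_theta_eq_localDet_theta`) and `χ_{f,v}(θ_{ε′} z) = χ_{f,v}(θ_ε z)` (★ `localCharOfCenter_theta_eq`: the finite-adèlic point «`z` at the places over `v`,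
`1` elsewhere» is the same for both lines), and apply the hypothesis at `u = θ_ε(z)`.
[cite: GelbartRogawski1991, §5.1 (5.1.1) p. 465; proof of Prop. 5.2.1 p. 467 L25–27] [cite: TateThesis1967, §3.2 Lemma 3.2.1] -/
theorem isThetaCenterChar_indep (μ : Literature.NumberTheory.Automorphic.IdeleClassGroup L →ₜ* Circle)
    (χf : UnitaryGroup.finAdelicOne (↥(maximalRealSubfield L)) L (IsCMField.complexConj L) →* ℂˣ) {ε : (↥(maximalRealSubfield L))ˣ}
    (v : HeightOneSpectrum (𝓞 ↥(maximalRealSubfield L))) {ψθ : ↥(normOneUnits (conjLocal L (IsCMField.complexConj L) v)) →* ℂˣ}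
    (h : IsThetaCenterChar L μ χf ε v ψθ) (ε' : (↥(maximalRealSubfield L))ˣ) : IsThetaCenterChar L μ χf ε' v ψθ := by
  intro u
  -- `u = θ_{ε′} z`
  obtain ⟨z, rfl⟩ := LemD1OfPlace.theta_surjective L v (IsCMField.complexConj L) 2 (1 : Matrix (Fin 2) (Fin 2) L) (hcδ' L)
    (imagUnit_ne_zero L) le_rfl (one_map_transpose L) (one_det_ne_zero L) (JW (↥(maximalRealSubfield L)) L ε')
    (JW_apply_ne_zero (↥(maximalRealSubfield L)) L ε') u
  -- `det θ_{ε′} z = det θ_ε z`, then the hypothesis at `θ_ε z`, then the line-independence of the centre inclusion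
  rw [← localDet_theta_eq_localDet_theta L v ε ε' z, h,
    Def411WeilCarriers.localCharOfCenter_theta_eq (↥(maximalRealSubfield L)) L (IsCMField.complexConj L) 2
      (1 : Matrix (Fin 2) (Fin 2) L) (hcδ' L) (imagUnit_ne_zero L) le_rfl (one_map_transpose L) (one_det_ne_zero L) v
      (JW (↥(maximalRealSubfield L)) L ε) (JW (↥(maximalRealSubfield L)) L ε') (JW_apply_ne_zero (↥(maximalRealSubfield L)) L ε)
      (JW_apply_ne_zero (↥(maximalRealSubfield L)) L ε') χf z]

/-- **GLUE-I as an `iff`**: for any two lines, `IsThetaCenterChar … ε v ψθ ↔ IsThetaCenterChar … ε′ v ψθ`. [cite: GelbartRogawski1991, §5.1 (5.1.1) p. 465] -/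
theorem isThetaCenterChar_iff_of_line (μ : Literature.NumberTheory.Automorphic.IdeleClassGroup L →ₜ* Circle)
    (χf : UnitaryGroup.finAdelicOne (↥(maximalRealSubfield L)) L (IsCMField.complexConj L) →* ℂˣ) (ε ε' : (↥(maximalRealSubfield L))ˣ)
    (v : HeightOneSpectrum (𝓞 ↥(maximalRealSubfield L))) (ψθ : ↥(normOneUnits (conjLocal L (IsCMField.complexConj L) v)) →* ℂˣ) :
    IsThetaCenterChar L μ χf ε v ψθ ↔ IsThetaCenterChar L μ χf ε' v ψθ :=
  ⟨fun h => isThetaCenterChar_indep L μ χf v h ε', fun h => isThetaCenterChar_indep L μ χf v h ε⟩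

/-- **Stub GLUE-I `StubThetaCenterCharIndep` of typ-T7b's local-D7α Lines draft (`F0/P2/Lines-draft/T7b_LocalThetaDichotomy.lean` v1.5 :273–280), statement
VERBATIM** — consumed there by `stubNonOccurringClass_of_letters` (OCC ⟸ U1 letter + GLUE-O ★ + GLUE-I).  Closed by `isThetaCenterChar_indep`, unconditionally.
[cite: GelbartRogawski1991, §5.1 (5.1.1) p. 465; Remark p. 466] -/
theorem stubThetaCenterCharIndep_holds :
    ∀ (L : Type) [Field L] [NumberField L] [IsCMField L]
      (μ : Literature.NumberTheory.Automorphic.IdeleClassGroup L →ₜ* Circle)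
      (χf : UnitaryGroup.finAdelicOne (↥(maximalRealSubfield L)) L (IsCMField.complexConj L) →* ℂˣ)
      (ε ε' : (↥(maximalRealSubfield L))ˣ) (v : HeightOneSpectrum (𝓞 ↥(maximalRealSubfield L)))
      (ψθ : ↥(normOneUnits (conjLocal L (IsCMField.complexConj L) v)) →* ℂˣ),
      IsThetaCenterChar L μ χf ε v ψθ → IsThetaCenterChar L μ χf ε' v ψθ :=
  fun L _ _ _ μ χf _ ε' v _ h => isThetaCenterChar_indep L μ χf v h ε'

/-! ## §2 At a NON-SPLIT `v`: `ψθ` is determined by `(μ, χ_f)` (F0P2-p02 (g5)'s salvage §2, verbatim) -/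

section Rigidity

variable (v : HeightOneSpectrum (𝓞 ↥(maximalRealSubfield L)))

set_option synthInstance.maxHeartbeats 400000 in
set_option maxHeartbeats 8000000 in
/-- **The `U(1)`-character on quotients `x/x̄` is LINE-FREE**: if ★ `IsThetaCenterChar L μ χf ε v ψθ` then for every unit `x` of `L ⊗ L⁺_v`,
`ψθ(x/x̄) = χ_f(∏_{w∣v} single_w(x_w) / conj) · μ_v(x/x̄)⁻¹` — evaluate the defining identity at the scalar `θ(x/x̄) ∈ U((ε))(L⁺_v)` of the rank-2
standing data (★ `LemD1OfPlace.theta`; `det θ(z) = z`, ★ `coe_localDet_localPiEquiv_theta`) and read the centre character there by ★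
`CheckOfChi.finAdelicCheck_prod_unitsMap_finiteAdeleSingle`; the right-hand side does not mention `ε`. [cite: Liu2021, Def. 4.1, App. D §D.1 (l. 5221–5224)]
[cite: GelbartRogawski1991, §5.1 (5.1.1) p. 465] -/
theorem isThetaCenterChar_apply_quotConj (μ : Literature.NumberTheory.Automorphic.IdeleClassGroup L →ₜ* Circle)
    (χf : UnitaryGroup.finAdelicOne (↥(maximalRealSubfield L)) L (IsCMField.complexConj L) →* ℂˣ) {ε : (↥(maximalRealSubfield L))ˣ}
    {ψθ : ↥(normOneUnits (conjLocal L (IsCMField.complexConj L) v)) →* ℂˣ} (hspec : IsThetaCenterChar L μ χf ε v ψθ)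
    (x : (UnitaryGroup.LocalRing L v)ˣ) :
    ψθ (quotConj (conjLocal L (IsCMField.complexConj L) v) (conjLocal_conjLocal_cm L v) x) =
      χf (finAdelicCheck (↥(maximalRealSubfield L)) L (IsCMField.complexConj L)
          (AlgEquiv.ext fun y => by rw [AlgEquiv.mul_apply, IsCMField.complexConj_apply_apply, AlgEquiv.one_apply])
          (∏ w : UnitaryGroup.PlacesOver L v, Units.map (finiteAdeleSingle w.1) (Units.map (Pi.evalRingHom _ w).toMonoidHom x))) *
        ((toHeckeCharacter L μ).semilocalComponent L v
          ((quotConj (conjLocal L (IsCMField.complexConj L) v) (conjLocal_conjLocal_cm L v) x :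
            ↥(normOneUnits (conjLocal L (IsCMField.complexConj L) v))) : (UnitaryGroup.LocalRing L v)ˣ))⁻¹ := by
  have hcc : IsCMField.complexConj L * IsCMField.complexConj L = 1 :=
    AlgEquiv.ext fun y => by rw [AlgEquiv.mul_apply, IsCMField.complexConj_apply_apply, AlgEquiv.one_apply]
  -- the scalar `θ(x/x̄) ∈ U((ε))(L⁺_v)` of the standing data at `v` (rank 2, Gram `1`, `δ = imagUnit L`)
  have h1 := hspec (LemD1OfPlace.theta L v (IsCMField.complexConj L) 2 (1 : Matrix (Fin 2) (Fin 2) L) (hcδ' L) (imagUnit_ne_zero L) le_rfl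
    (one_map_transpose L) (one_det_ne_zero L) (JW (↥(maximalRealSubfield L)) L ε)
    ((LemD1OfPlace.standingData L v (IsCMField.complexConj L) 2 (1 : Matrix (Fin 2) (Fin 2) L) (hcδ' L) (imagUnit_ne_zero L) le_rfl
      (one_map_transpose L) (one_det_ne_zero L)).divConj x))
  -- `det (θ(x/x̄)) = x/x̄`
  have hdet : localDet (IsCMField.complexConj L) v
      (isUnit_iff_ne_zero.mpr (by rw [Matrix.det_fin_one]; exact JW_apply_ne_zero (↥(maximalRealSubfield L)) L ε))
      (localPiEquiv L (IsCMField.complexConj L) 1 (JW (↥(maximalRealSubfield L)) L ε) v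
        (LemD1OfPlace.theta L v (IsCMField.complexConj L) 2 (1 : Matrix (Fin 2) (Fin 2) L) (hcδ' L) (imagUnit_ne_zero L) le_rfl
          (one_map_transpose L) (one_det_ne_zero L) (JW (↥(maximalRealSubfield L)) L ε)
          ((LemD1OfPlace.standingData L v (IsCMField.complexConj L) 2 (1 : Matrix (Fin 2) (Fin 2) L) (hcδ' L) (imagUnit_ne_zero L) le_rfl
            (one_map_transpose L) (one_det_ne_zero L)).divConj x))) =
      quotConj (conjLocal L (IsCMField.complexConj L) v) (conjLocal_conjLocal_cm L v) x := by
    apply Subtype.ext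
    rw [F0P2oStubDictTorusChar.coe_localDet_localPiEquiv_theta L v _
        ((LemD1OfPlace.standingData L v (IsCMField.complexConj L) 2 (1 : Matrix (Fin 2) (Fin 2) L) (hcδ' L) (imagUnit_ne_zero L) le_rfl
          (one_map_transpose L) (one_det_ne_zero L)).divConj x), coe_quotConj,
      Literature.RepresentationTheory.Liu2021.OscillatorStandingData.coe_divConj, div_eq_mul_inv]
    rfl
  rw [hdet] at h1
  -- the centre character at `θ(x/x̄)` is `χ_f (∏_w single_w(x_w) / conj)`
  have h2 : localCharOfCenter (↥(maximalRealSubfield L)) L (IsCMField.complexConj L) (JW (↥(maximalRealSubfield L)) L ε)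
        (JW_apply_ne_zero (↥(maximalRealSubfield L)) L ε) χf v
        (LemD1OfPlace.theta L v (IsCMField.complexConj L) 2 (1 : Matrix (Fin 2) (Fin 2) L) (hcδ' L) (imagUnit_ne_zero L) le_rfl
          (one_map_transpose L) (one_det_ne_zero L) (JW (↥(maximalRealSubfield L)) L ε)
          ((LemD1OfPlace.standingData L v (IsCMField.complexConj L) 2 (1 : Matrix (Fin 2) (Fin 2) L) (hcδ' L) (imagUnit_ne_zero L) le_rfl
            (one_map_transpose L) (one_det_ne_zero L)).divConj x)) =
      χf (finAdelicCheck (↥(maximalRealSubfield L)) L (IsCMField.complexConj L) hcc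
        (∏ w : UnitaryGroup.PlacesOver L v, Units.map (finiteAdeleSingle w.1) (Units.map (Pi.evalRingHom _ w).toMonoidHom x))) := by
    rw [localCharOfCenter_apply,
      CheckOfChi.finAdelicCheck_prod_unitsMap_finiteAdeleSingle hcc (hcδ' L) (imagUnit_ne_zero L) le_rfl (one_map_transpose L)
        (one_det_ne_zero L) (JW_apply_ne_zero (↥(maximalRealSubfield L)) L ε) x]
    rfl
  rw [h1, h2]

/-- **UNIQUENESS ACROSS LINES at a non-split `v`**: two characters satisfying ★ `IsThetaCenterChar` for the same `(μ, χ_f)` and ANY two line classes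
`ε, ε'` coincide — by the line-free formula on quotients `x/x̄` and local Hilbert 90 (★ `exists_quotConj_eq_of_nonsplit`: every norm-one unit is a
quotient at a non-split place). [cite: CasselsFrohlichANT1967, Ch. V §2.7 Prop. 5] [cite: GelbartRogawski1991, §5.1 (5.1.1) p. 465] -/
theorem isThetaCenterChar_unique (hv : ∀ w : UnitaryGroup.PlacesOver L v, IsCMField.complexConj L • w.1 = w.1)
    (μ : Literature.NumberTheory.Automorphic.IdeleClassGroup L →ₜ* Circle)
    (χf : UnitaryGroup.finAdelicOne (↥(maximalRealSubfield L)) L (IsCMField.complexConj L) →* ℂˣ) {ε ε' : (↥(maximalRealSubfield L))ˣ}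
    {ψθ ψθ' : ↥(normOneUnits (conjLocal L (IsCMField.complexConj L) v)) →* ℂˣ} (h : IsThetaCenterChar L μ χf ε v ψθ)
    (h' : IsThetaCenterChar L μ χf ε' v ψθ') : ψθ = ψθ' := by
  refine MonoidHom.ext fun β => ?_
  obtain ⟨x, rfl⟩ := F0P2oStubDictTorusChar.exists_quotConj_eq_of_nonsplit L v hv β
  rw [isThetaCenterChar_apply_quotConj L v μ χf h x, isThetaCenterChar_apply_quotConj L v μ χf h' x]

end Rigidity

end Summit.HodgeConjecture.HodgeConjecture.Cruxes.H413.F0P2oThetaCenterCharIndep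

end
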